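import Literature.AlgebraicGeometry.GroupSchemes.RelativeFrobeniusFibre
import Literature.AlgebraicGeometry.AbelianSchemes.AbelianSchemeOverFibreConjugate
import HarnessLib

/-!
# The fibre of an abelian scheme at a Frobenius-moved point is the Frobenius twist of the fibre, and the level
# sections move by the relative Frobenius (Milne, *Étale cohomology* VI Rem. 13.5; Shimura 1998 §18.6 «`(t^σ)~ = π(t̃)`»)

Topic `AlgebraicGeometry/AbelianSchemes`; namespace `Literature.AlgebraicGeometry.AbelianSchemes.AbelianSchemeOver`.
DEFINITIONS WITH BODIES (one isomorphism of abelian varieties, assembled from ★ `conjFibreIso` and an `eqToIso`) and fully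
proved theorems: **no named fact, no `sorry`, no instance, no notation**.  Cell `pub/hodgecm-mathlib`, programme P6 («MOD»),
piece (d1), abelian-scheme reading (the currency of the pointwise dictionary DICT (c3a) of the door P″: universal abelian
scheme `A → S` over the special fibre `S` of a model, `S` a `k = 𝔽_q`-scheme, geometric points `x : Spec κ̄ → S` over `k`,
`F = ` ★ `frobeniusOver S` acting on them by `x ↦ x ≫ F`).

## Mathematics

Let `k = 𝔽_q`, `q = p^r`, `S` a `k`-scheme, `A → S` an abelian scheme, `L ⊇ k` a perfect field and `x : Spec L → S` an
`L`-valued point over `k`.  The `q`-Frobenius MOVES `x` to `x ≫ F_S = Spec(Frob^r) ≫ x` (★ `RelFrobenius.comp_frobeniusOver_left`),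
so the fibre there is the base change of the fibre `A_x` along `Frob^r : L → L`, i.e. the Frobenius twist `A_x^{(q)}` of B-p12
(★ `AbelianVariety.frobeniusTwist`, which over a perfect field IS the conjugate `A_x^{Frob^r}`, ★ `frobeniusTwist_eq_conjugate`):
**`A_{x ≫ F_S} ≅ (A_x)^{(q)}`** (★ `conjFibreIso`, [GortzWedhorn2020, Prop. 4.16]).  Under this isomorphism the value at the
moved point of any section `τ` of `A → S` (★ `restrictPt`, the currency of level structures) is the image under the relative
Frobenius `F_{A_x/L} : A_x → A_x^{(q)}` (★ `AbelianVariety.relFrobenius`) of its value at `x`: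
**`τ(x ≫ F_S) ↦ F_{A_x/L}(τ(x))`** — Shimura's «`(t^σ)~ = π(t̃)`» ∕ Milne's «`F` acts by raising the coordinates to the `q`-th
power» (★ `map_relFrobenius_eq_conjPoints`, ★ `map_conjFibreIso_conjPoints_restrictPt`).  So the moduli datum
`(A, τ)` at `F(x)` is `(A_x^{(q)}, F_{A_x/L} ∘ τ_x)`: the Eichler–Shimura∕congruence-relation input.

## Contents (`A : AbelianSchemeOver S.left`, `x : specOver k L ⟶ S`, `[ExpChar L p] [PerfectRing L p]`, `hq : Nat.card k = p ^ r`)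
* `fibreCongrPtIso` (transport of the fibre along an equality of points) with `map_fibreCongrPtIso_restrictPt`;
* **`fibreFrobeniusTwistIso A p r hq x : (A.fibre (x ≫ frobeniusOver S).left).toAbelianVariety ≅
  ((A.fibre x.left).toAbelianVariety).frobeniusTwist p r`**;
* **`map_fibreFrobeniusTwistIso_restrictPt`**: it carries `A.restrictPt (x ≫ F_S).left τ` to
  `F_{A_x/L} (A.restrictPt x.left τ)`; `exists_iso_fibre_frobenius_map_restrictPt` (def-free packaging).

HC_CM is proved only modulo the printed citations until rung 0 closes; this file changes no count.

## References
* [Milne2025] J. S. Milne, *Étale cohomology*, VI §13 Rem. 13.5 (`X^{(q)}`, `F_{X/k}`, «raising coordinates to the `q`-th power»).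
* [Shimura1998] G. Shimura, *Abelian varieties with complex multiplication and modular functions*, §18.6 proof of Thm. 18.6,
  pp. 127–128 («`π : Ã → Ã^f`», «`(t^σ)~ = π(t̃)`»).
* [GortzWedhorn2020] U. Görtz, T. Wedhorn, *Algebraic Geometry I* (2nd ed.), Section (4.7), Prop. 4.16.
* [MumfordFogartyKirwan1994] D. Mumford, J. Fogarty, F. Kirwan, *GIT* (3rd ed.), Ch. 7 §2 Def. 7.1 (sections on fibres).
-/

set_option autoImplicit false

noncomputable section

-- `(specOver k L).left = Spec L`, `specTwist (iterateFrobeniusEquiv L p r) = frobSpec L p r` and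
-- `A.frobeniusTwist p r = A.conjugate (iterateFrobeniusEquiv L p r)` are definitional only above `instances` transparency
-- (as in ★ `AbelianSchemeOverFibreConjugate` and ★ `Motives/AbelianVarietyFrobeniusTwistVariety`).
set_option backward.isDefEq.respectTransparency false

universe u

open CategoryTheory CategoryTheory.Limits AlgebraicGeometry

namespace Literature.AlgebraicGeometry.AbelianSchemes

namespace AbelianSchemeOver

open Literature.AlgebraicGeometry.Motives Literature.AlgebraicGeometry.GroupSchemes

variable {S₀ : Scheme.{u}} (A : AbelianSchemeOver S₀) {L : Type u} [Field L]

/-! ## Transport of the fibre along an equality of points -/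

section Congr

variable {s₁ s₂ : Spec (.of L) ⟶ S₀}

/-- Transport of the fibre abelian variety along an EQUALITY of base points (`eqToIso`; the composite isomorphisms below have
base points that agree only propositionally, `x ≫ F_S = Spec Frob^r ≫ x`). [cite: GortzWedhorn2020, Section (4.7), Prop. 4.16] -/
def fibreCongrPtIso (h : s₁ = s₂) : (A.fibre s₁).toAbelianVariety ≅ (A.fibre s₂).toAbelianVariety :=
  eqToIso (by rw [h])

/-- The transport carries the value of a section at `s₁` to its value at `s₂`. [cite: MumfordFogartyKirwan1994, Ch. 7 §2 Definition 7.1 (p. 129)] -/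
theorem map_fibreCongrPtIso_restrictPt (h : s₁ = s₂) (τ : A.Sections) :
    AlgPoints.map (A.fibreCongrPtIso h).hom.hom.hom.hom (A.restrictPt s₁ τ) = A.restrictPt s₂ τ := by
  subst h
  exact Category.comp_id _

end Congr

/-! ## The fibre at the Frobenius-moved point -/

section Frobenius

variable {k : Type u} [Field k] [Finite k] {S : SchemeOver k} (A : AbelianSchemeOver S.left) {L : Type u} [Field L]
  [Algebra k L] (p r : ℕ) [ExpChar L p] [PerfectRing L p]

/-- The moved point in the conjugate-junction form: `(x ≫ F_S) = Spec (Frob^r)⁼ ≫ x` with `Frob^r` the ring AUTOMORPHISM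
`iterateFrobeniusEquiv L p r` of the perfect field `L` (★ `RelFrobenius.comp_frobeniusOver_left`). [cite: Milne2025, VI §13 Rem. 13.5] -/
theorem comp_frobeniusOver_left_eq_specTwist_comp (hq : Nat.card k = p ^ r) (x : specOver k L ⟶ S) :
    (x ≫ frobeniusOver S).left = specTwist (iterateFrobeniusEquiv L p r) ≫ x.left :=
  RelFrobenius.comp_frobeniusOver_left S p r hq x

/-- **The fibre at the Frobenius-moved point is the Frobenius twist of the fibre**:
`A_{x ≫ F_S} ≅ (A_x)^{(q)}` as abelian varieties over the perfect field `L` (`q = #k = p^r`; transport along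
`x ≫ F_S = Spec Frob^r ≫ x`, then ★ `conjFibreIso` read through ★ `frobeniusTwist_eq_conjugate`).
[cite: Milne2025, VI §13 Rem. 13.5] [cite: GortzWedhorn2020, Section (4.7), Prop. 4.16] -/
def fibreFrobeniusTwistIso (hq : Nat.card k = p ^ r) (x : specOver k L ⟶ S) :
    (A.fibre (x ≫ frobeniusOver S).left).toAbelianVariety ≅ ((A.fibre x.left).toAbelianVariety).frobeniusTwist p r :=
  A.fibreCongrPtIso (comp_frobeniusOver_left_eq_specTwist_comp p r hq x) ≪≫
    (A.conjFibreIso (iterateFrobeniusEquiv L p r) x.left).symm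

/-- For an isomorphism `φ : X ≅ Y` of abelian varieties: if `φ` carries the point `P` to `Q`, then `φ⁻¹` carries `Q` to `P`.
[cite: GortzWedhorn2020, Section (4.7)] -/
private theorem map_inv_eq_of_map_hom_eq_frob {K : Type u} [Field K] {X Y : AbelianVariety K} (φ : X ≅ Y) {Ω : Type u} [Field Ω]
    [Algebra K Ω] {P : AlgPoints X.X Ω} {Q : AlgPoints Y.X Ω} (h : AlgPoints.map φ.hom.hom.hom.hom P = Q) :
    AlgPoints.map φ.inv.hom.hom.hom Q = P := by
  rw [← h]
  change (P ≫ φ.hom.hom.hom.hom) ≫ φ.inv.hom.hom.hom = P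
  have hφ : φ.hom.hom.hom.hom ≫ φ.inv.hom.hom.hom = 𝟙 _ := congrArg (fun ψ => ψ.hom.hom.hom) φ.hom_inv_id
  rw [Category.assoc, hφ, Category.comp_id]

/-- **Sections move by the relative Frobenius**: under `fibreFrobeniusTwistIso`, the value at the moved point `x ≫ F_S` of a
section `τ` of `A → S` is `F_{A_x/L}(τ(x))`, the image of its value at `x` under B-p12's homomorphism
`relFrobenius p r : A_x → A_x^{(q)}` (Shimura «`(t^σ)~ = π(t̃)`»; Milne «`F` raises the coordinates of a point to the `q`-th
power»). [cite: Shimura1998, §18.6 proof of Thm. 18.6, p. 128] [cite: Milne2025, VI §13 Rem. 13.5] -/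
theorem map_fibreFrobeniusTwistIso_restrictPt (hq : Nat.card k = p ^ r) (x : specOver k L ⟶ S) (τ : A.Sections) :
    AlgPoints.map (A.fibreFrobeniusTwistIso p r hq x).hom.hom.hom.hom (A.restrictPt (x ≫ frobeniusOver S).left τ) =
      AlgPoints.map ((A.fibre x.left).toAbelianVariety.relFrobenius p r).hom.hom.hom (A.restrictPt x.left τ) := by
  rw [AbelianVariety.map_relFrobenius_eq_conjPoints]
  have h1 := A.map_fibreCongrPtIso_restrictPt (comp_frobeniusOver_left_eq_specTwist_comp p r hq x) τ
  have h2 : AlgPoints.map (A.conjFibreIso (iterateFrobeniusEquiv L p r) x.left).inv.hom.hom.hom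
      (A.restrictPt (specTwist (iterateFrobeniusEquiv L p r) ≫ x.left) τ) =
      (A.fibre x.left).toAbelianVariety.conjPoints (iterateFrobeniusEquiv L p r) (A.restrictPt x.left τ) :=
    map_inv_eq_of_map_hom_eq_frob (A.conjFibreIso (iterateFrobeniusEquiv L p r) x.left)
      (A.map_conjFibreIso_conjPoints_restrictPt (iterateFrobeniusEquiv L p r) x.left τ)
  calc AlgPoints.map (A.fibreFrobeniusTwistIso p r hq x).hom.hom.hom.hom (A.restrictPt (x ≫ frobeniusOver S).left τ)
      = AlgPoints.map (A.conjFibreIso (iterateFrobeniusEquiv L p r) x.left).inv.hom.hom.hom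
          (AlgPoints.map (A.fibreCongrPtIso (comp_frobeniusOver_left_eq_specTwist_comp p r hq x)).hom.hom.hom.hom
            (A.restrictPt (x ≫ frobeniusOver S).left τ)) :=
          (Category.assoc _ _ _).symm
    _ = (A.fibre x.left).toAbelianVariety.conjPoints (iterateFrobeniusEquiv L p r) (A.restrictPt x.left τ) := by
          rw [h1, h2]

/-- **Def-free packaging for consumers**: there is an isomorphism `A_{x ≫ F_S} ≅ (A_x)^{(q)}` of abelian varieties over `L`
carrying, for every section `τ` of `A → S`, the value `τ(x ≫ F_S)` to `F_{A_x/L}(τ(x))`. [cite: Milne2025, VI §13 Rem. 13.5]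
[cite: Shimura1998, §18.6 proof of Thm. 18.6, p. 128] -/
theorem exists_iso_fibre_frobeniusOver_map_restrictPt (hq : Nat.card k = p ^ r) (x : specOver k L ⟶ S) :
    ∃ e : (A.fibre (x ≫ frobeniusOver S).left).toAbelianVariety ≅ ((A.fibre x.left).toAbelianVariety).frobeniusTwist p r,
      ∀ τ : A.Sections, AlgPoints.map e.hom.hom.hom.hom (A.restrictPt (x ≫ frobeniusOver S).left τ) =
        AlgPoints.map ((A.fibre x.left).toAbelianVariety.relFrobenius p r).hom.hom.hom (A.restrictPt x.left τ) :=
  ⟨A.fibreFrobeniusTwistIso p r hq x, A.map_fibreFrobeniusTwistIso_restrictPt p r hq x⟩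

end Frobenius

end AbelianSchemeOver

end Literature.AlgebraicGeometry.AbelianSchemes
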